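import Literature.AlgebraicGeometry.Resolution.WeightedCentreTheoremFPrime
import Literature.AlgebraicGeometry.Resolution.MvPolynomialKillVars
import HarnessLib

/-!
# Weighted centres — PIN TRANSPORT to the honest face: `SlotPinned w l g → SlotPinned (w ∘ val) ⟨l, _⟩ (killCompl g)`

Instrument for engine 1's `W(f)` TOY MODEL (cell `pub-rosobs`, LF-MODEL-eng1-g45 §6.2 REDUCTION, the hypothesis "(P) on the face" needed to run THEOREM 𝔉′ / THEOREM B /
THEOREM A⁺ verbatim on the honest face ring `k[ε_{¬Z}][σ]`; CARVER-NOTES-eng1-g47 §3 ROUTE P), NOT a resolution theorem and NOT about the invariant of [AbramovichTemkinWlodarczyk2024].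

Given a graded automorphism pair `(Φ, Φ')` of the face ring `L[ε_{¬Z}]`, extend it by the identity on the `Z`-variables (`extendZ`), a graded automorphism pair of `L[ε]`
(`isGradedAutPair_extendZ`); killing the `Z`-variables intertwines the two (`killLight_extendZ`), kills compose (`Truncation.killLight_killLight_of_imp`, tree) and commute with renamings (`killLight_rename_of_comp`);
so if every slot of `Z` is lighter than `l`, (P) at `l` for `g` gives (P) at `⟨l, _⟩` for the face polynomial `killCompl g` (`SlotPinned.killCompl`).

References: [AbramovichTemkinWlodarczyk2024, §5.1 (p. 1575)]; [Lang2002, Ch. IV §1, Ch. XIII §4].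
-/

namespace Literature.AlgebraicGeometry.Resolution.WeightedBlowup

open _root_.MvPolynomial Truncation

section Kill

variable {L : Type*} [CommRing L] {ι κ : Type*}

/-- **Killing light variables across a renaming**: `killLight H (rename f Q) = rename f (killLight (H ∘ f) Q)` (bookkeeping). [cite: AbramovichTemkinWlodarczyk2024, §5.1 (p. 1575)] -/
theorem killLight_rename_of_comp (H : ι → Prop) [DecidablePred H] (f : κ → ι) (Q : MvPolynomial κ L) :
    killLight H (rename f Q) = rename f (killLight (fun j => H (f j)) Q) := by
  induction Q using MvPolynomial.induction_on with
  | C a => simp only [MvPolynomial.algHom_C, AlgHom.commutes]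
  | add P Q hP hQ => simp only [map_add, hP, hQ]
  | mul_X P i hP =>
    rw [map_mul, rename_X, map_mul, killLight_X, hP, map_mul, killLight_X, map_mul]
    congr 1
    rw [heavyX, heavyX]
    by_cases h : H (f i)
    · rw [if_pos h, if_pos h, rename_X]
    · rw [if_neg h, if_neg h, map_zero]

/-- Killing nothing is the identity (bookkeeping). [cite: AbramovichTemkinWlodarczyk2024, §5.1 (p. 1575)] -/
theorem killLight_of_forall (H : ι → Prop) [DecidablePred H] (hH : ∀ j, H j) (P : MvPolynomial ι L) : killLight H P = P := by
  conv_rhs => rw [← AlgHom.id_apply (R := L) P]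
  refine DFunLike.congr_fun (MvPolynomial.algHom_ext fun j => ?_) P
  rw [killLight_X, heavyX, if_pos (hH j), AlgHom.id_apply]

end Kill

section Transport

variable {L : Type*} [Field L] {ι : Type*} (w : ι → ℚ) (Z : Set ι) [DecidablePred (· ∈ Z)]

omit [DecidablePred (· ∈ Z)] in
/-- Weighted homogeneity ascends along `rename Subtype.val` (face weights `w ∘ Subtype.val`; bookkeeping). [cite: Lang2002, Ch. IV §1] -/
theorem isWeightedHomogeneous_rename_val {Q : MvPolynomial {j : ι // j ∉ Z} L} {m : ℚ} (h : IsWeightedHomogeneous (w ∘ Subtype.val) Q m) :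
    IsWeightedHomogeneous w (rename Subtype.val Q) m := by
  classical
  intro d hd
  have hd' : d ∈ (rename Subtype.val Q).support := mem_support_iff.mpr hd
  rw [support_rename_of_injective Subtype.val_injective] at hd'
  obtain ⟨e, he, rfl⟩ := Finset.mem_image.mp hd'
  have hmap : Finsupp.weight w (e.mapDomain Subtype.val) = Finsupp.weight (w ∘ Subtype.val) e := by
    simp only [Finsupp.weight_apply]
    exact Finsupp.sum_mapDomain_index (fun _ => zero_smul ℕ _) (fun _ _ _ => add_smul _ _ _)
  rw [hmap]
  exact h (mem_support_iff.mp he)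

/-- **Extension of a face endomorphism by the identity on the `Z`-variables** (the `liftHom` pattern of `Truncation`, for a set of slots; ours).
[cite: AbramovichTemkinWlodarczyk2024, §5.1 (p. 1575)] -/
noncomputable def extendZ (Φ : MvPolynomial {j : ι // j ∉ Z} L →ₐ[L] MvPolynomial {j : ι // j ∉ Z} L) : MvPolynomial ι L →ₐ[L] MvPolynomial ι L :=
  aeval fun j => if h : j ∈ Z then X j else rename Subtype.val (Φ (X ⟨j, h⟩))

/-- `extendZ Φ` fixes the `Z`-variables (bookkeeping). [cite: AbramovichTemkinWlodarczyk2024, §5.1 (p. 1575)] -/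
theorem extendZ_X_of_mem (Φ : MvPolynomial {j : ι // j ∉ Z} L →ₐ[L] MvPolynomial {j : ι // j ∉ Z} L) {j : ι} (hj : j ∈ Z) :
    extendZ Z Φ (X j) = X j := by
  rw [extendZ, aeval_X, dif_pos hj]

/-- `extendZ Φ` on a surviving variable (bookkeeping). [cite: AbramovichTemkinWlodarczyk2024, §5.1 (p. 1575)] -/
theorem extendZ_X_of_not_mem (Φ : MvPolynomial {j : ι // j ∉ Z} L →ₐ[L] MvPolynomial {j : ι // j ∉ Z} L) {j : ι} (hj : j ∉ Z) :
    extendZ Z Φ (X j) = rename Subtype.val (Φ (X ⟨j, hj⟩)) := by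
  rw [extendZ, aeval_X, dif_neg hj]

/-- `extendZ Φ ∘ rename val = rename val ∘ Φ` (bookkeeping). [cite: AbramovichTemkinWlodarczyk2024, §5.1 (p. 1575)] -/
theorem extendZ_rename (Φ : MvPolynomial {j : ι // j ∉ Z} L →ₐ[L] MvPolynomial {j : ι // j ∉ Z} L) (Q : MvPolynomial {j : ι // j ∉ Z} L) :
    extendZ Z Φ (rename Subtype.val Q) = rename Subtype.val (Φ Q) := by
  rw [← AlgHom.comp_apply, ← AlgHom.comp_apply]
  refine DFunLike.congr_fun (MvPolynomial.algHom_ext fun j => ?_) Q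
  rw [AlgHom.comp_apply, AlgHom.comp_apply, rename_X, extendZ_X_of_not_mem Z Φ j.2]

/-- **The extension of a graded automorphism pair of the face is a graded automorphism pair** (bookkeeping). [cite: AbramovichTemkinWlodarczyk2024, §5.1 (p. 1575)] -/
theorem Truncation.isGradedAutPair_extendZ {Φ Φ' : MvPolynomial {j : ι // j ∉ Z} L →ₐ[L] MvPolynomial {j : ι // j ∉ Z} L}
    (h : IsGradedAutPair (w ∘ Subtype.val) Φ Φ') : IsGradedAutPair w (extendZ Z Φ) (extendZ Z Φ') := by
  have hgr : ∀ Ψ : MvPolynomial {j : ι // j ∉ Z} L →ₐ[L] MvPolynomial {j : ι // j ∉ Z} L, IsGraded (w ∘ Subtype.val) Ψ →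
      IsGraded w (extendZ Z Ψ) := fun Ψ hΨ j => by
    by_cases hj : j ∈ Z
    · rw [extendZ_X_of_mem Z Ψ hj]
      exact isWeightedHomogeneous_X L w j
    · rw [extendZ_X_of_not_mem Z Ψ hj]
      exact isWeightedHomogeneous_rename_val w Z (hΨ ⟨j, hj⟩)
  have hinv : ∀ Ψ Ψ' : MvPolynomial {j : ι // j ∉ Z} L →ₐ[L] MvPolynomial {j : ι // j ∉ Z} L, (∀ q, Ψ (Ψ' q) = q) →
      ∀ P, extendZ Z Ψ (extendZ Z Ψ' P) = P := fun Ψ Ψ' hΨ P => by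
    rw [← AlgHom.comp_apply]
    conv_rhs => rw [← AlgHom.id_apply (R := L) P]
    refine DFunLike.congr_fun (MvPolynomial.algHom_ext fun j => ?_) P
    rw [AlgHom.comp_apply, AlgHom.id_apply]
    by_cases hj : j ∈ Z
    · rw [extendZ_X_of_mem Z Ψ' hj, extendZ_X_of_mem Z Ψ hj]
    · rw [extendZ_X_of_not_mem Z Ψ' hj, extendZ_rename, hΨ, rename_X]
  exact ⟨hgr Φ h.1, hgr Φ' h.2.1, hinv Φ Φ' h.2.2.1, hinv Φ' Φ h.2.2.2⟩

/-- **Killing the `Z`-variables intertwines `extendZ Φ` with `Φ ∘ killCompl`** (bookkeeping). [cite: AbramovichTemkinWlodarczyk2024, §5.1 (p. 1575)] -/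
theorem killLight_extendZ (Φ : MvPolynomial {j : ι // j ∉ Z} L →ₐ[L] MvPolynomial {j : ι // j ∉ Z} L) (P : MvPolynomial ι L) :
    killLight (fun j => j ∉ Z) (extendZ Z Φ P) =
      rename Subtype.val (Φ (_root_.MvPolynomial.killCompl (Subtype.val_injective (p := fun j : ι => j ∉ Z)) P)) := by
  rw [← AlgHom.comp_apply, ← AlgHom.comp_apply, ← AlgHom.comp_apply]
  refine DFunLike.congr_fun (MvPolynomial.algHom_ext fun j => ?_) P
  rw [AlgHom.comp_apply, AlgHom.comp_apply, AlgHom.comp_apply]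
  by_cases hj : j ∈ Z
  · have hr : j ∉ Set.range (Subtype.val : {j : ι // j ∉ Z} → ι) := by
      rintro ⟨a, ha⟩
      exact a.2 (ha ▸ hj)
    rw [extendZ_X_of_mem Z Φ hj, killLight_X, heavyX, if_neg (not_not.mpr hj),
      Literature.AlgebraicGeometry.Resolution.MvPolynomial.killCompl_X_of_not_mem_range _ hr, map_zero, map_zero]
  · rw [extendZ_X_of_not_mem Z Φ hj, killLight_rename_of_comp, killLight_of_forall _ (fun i => i.2),
      show (X j : MvPolynomial ι L) = X ((⟨j, hj⟩ : {j : ι // j ∉ Z}).val) from rfl,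
      Literature.AlgebraicGeometry.Resolution.MvPolynomial.killCompl_X_apply]

/-- **PIN TRANSPORT TO THE FACE** (CARVER-NOTES-eng1-g47 §3 ROUTE P): if every slot of `Z` is lighter than `l`, then (P) at `l` for `g` — `SlotPinned w l g` — implies (P) at `⟨l, _⟩`
for the face polynomial `killCompl g ∈ L[ε_{¬Z}]` with the face weights `w ∘ Subtype.val`.  Instrument for engine 1's `W(f)` toy model, NOT a resolution theorem.
[cite: AbramovichTemkinWlodarczyk2024, §5.1 (p. 1575); Lang2002, Ch. XIII §4] -/
theorem Truncation.SlotPinned.killCompl [DecidableEq ι] {l : ι} {g : MvPolynomial ι L} (hl : SlotPinned w l g) (hZ : ∀ j ∈ Z, w j < w l) (hlZ : l ∉ Z) :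
    SlotPinned (w ∘ Subtype.val) (⟨l, hlZ⟩ : {j : ι // j ∉ Z})
      (_root_.MvPolynomial.killCompl (Subtype.val_injective (p := fun j : ι => j ∉ Z)) g) := by
  intro Φ Φ' hpair
  have h := hl _ _ (isGradedAutPair_extendZ w Z hpair)
  have hH : ∀ j, w l ≤ w j → j ∉ Z := fun j hj hjZ => not_lt.mpr hj (hZ j hjZ)
  rw [IsPinnedIn, ← Truncation.killLight_killLight_of_imp (fun j => j ∉ Z) (fun j => w l ≤ w j) hH, killLight_extendZ,
    killLight_rename_of_comp] at h
  obtain ⟨j, hj, hjl⟩ := Finset.mem_image.mp (vars_rename _ _ h)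
  have hj' : j = ⟨l, hlZ⟩ := Subtype.ext hjl
  rw [hj'] at hj
  exact hj

end Transport

end Literature.AlgebraicGeometry.Resolution.WeightedBlowup
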